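/-
Copyright (c) 2026. All rights reserved.
Released under Apache 2.0 license as described in the file LICENSE.
Authors: abc-iut cell, wave-4 seat abc-iut-w4-d059 (proof-only; the (∗_j) consumer of [SemiAnbd] Thm 5.4 (i)
over the WEAKENED arithmetic branch-pair dictionary: compact subgroups, images in `Π_A` up to
`Π_A`-conjugation — the form a genuine, possibly non-cofinal, arithmetic Galois tower can supply).
-/
import Literature.AnabelianGeometry.SemiGraphs.ArithEstrangementNoBranchPair
import HarnessLib

/-!
# [SemiAnbd] Thm 5.4 (i): (∗_j) for arithmetically ample compact subgroups from the branch-pair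
# dictionary IN `Π_A` (proof-only)

Mochizuki, *Semi-graphs of anabelioids*, Publ. RIMS **42** (2006), §5, Def. 5.3 (i)(ii) p. 65 and the proof
of Thm 5.4 (i) p. 66 ("entirely parallel to … Theorem 3.7", with the author's Comments (6)(b): the fixed
branch-pairs of the finite levels "converge, in the profinite topology" — the identification of the
stabiliser with a branch-pair intersection happens in a COMPLETION, for COMPACT subgroups).
[cite: MochizukiSemiAnbd2006, Thm 5.4 (i) p.66]

PROOF-ONLY companion of abc-iut-w4-d029's `ArithEstrangementNoBranchPair.lean` (abc-iut cell, sub-DAG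
`plan/L3/SUBDAG-SemiAnbd-Thm54.md`, rows T54-3a / T54-B; seat abc-iut-w4-d059).  There (∗_j) for an
arithmetically ample `C` was derived from the dictionary (AI4′) `stabBranchPair` of abc-iut-w4-d053's
`ArithLevelData`, which puts the FULL stabiliser of EVERY compatible finite-level branch-pair system inside
a `Π^temp_𝔊`-conjugate `x · (Π_b ∩ h·Π_{b'}·h⁻¹) · x⁻¹`.  As recorded by abc-iut-w4-d053 (design note
2026-08-26T02:12:38Z) and abc-iut-L3-t6 (advisory F-t6g3-1 ⇒ T54, 03:39:11Z), that shape is not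
dischargeable for level systems drawn from a non-cofinal tower (the common kernel of the level actions fixes
everything) and, as in the geometric (I4′), the conjugator of a "profinite-positioned" pro-vertex lives in a
completion, not in `Π^temp_𝔊`.  What the proof of Thm 5.4 (i) actually USES is much less — only for the
COMPACT arithmetically ample `C` at hand, and only the IMAGE in `Π_A` up to `Π_A`-conjugation:

* `isOpen_conjSubgroup_iff'` — openness in `Π_A` is invariant under conjugation;
* `not_map_le_of_isTotallyArithEstranged` — **the estrangement contradiction, image form**: under total
  arithmetic estrangement, `aug(C)` for an arithmetically ample `C` lies in NO `Π_A`-conjugate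
  `a · aug(Π_b ∩ h·Π_{b'}·h⁻¹) · a⁻¹` (`b, b'` at one vertex `v`, `h ∈ Π_v`, `b' ≠ b ∨ h ∉ Π_b`) — that
  image would contain the open `a⁻¹ · aug(C) · a`;
* `hnobp_of_isArithAmple_of_augDict` / `hstar_of_isArithAmple_of_augDict` — abc-iut-w4-d029's two theorems
  with (AI4′) replaced by the WEAKER dictionary (AI4″) `hdictA`: "for every COMPACT `C ≤ Π^temp_𝔊` fixing a
  compatible finite-level branch-pair system, `aug(C) ≤ a · aug(Π_b ∩ h·Π_{b'}·h⁻¹) · a⁻¹` for some such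
  `v, b, b', h` and some `a ∈ Π_A`"; the consumer takes `IsCompact C` (which abc-iut-w4-d053's packaged
  `ArithLevelData.arithMaximalCompactStatementI_of` has at the call site and currently discards);
* `augDict_of_dict`, `augDict_of_cptDict` — (AI4′) as typed, and its compact-restricted `Π^temp_𝔊`-conjugate
  form (abc-iut-L3-t6's exit (A54)), both IMPLY (AI4″): nothing landed is invalidated, and whichever additive
  field the package owner hosts feeds this consumer.

No definition, no new named fact; the dictionary is a binder.  Nothing here takes a side on [IUTchIII]
Cor. 3.12; typed ≠ proved elsewhere.
-/

namespace Literature.AnabelianGeometry.SemiGraphs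

open CategoryTheory Topology

universe v u u' w w'

/-! ### Atoms in `Π_A` -/

section Atoms

variable {Gtp : Type u} [Group Gtp]
variable {PA : Type u'} [Group PA] [TopologicalSpace PA] [IsTopologicalGroup PA]
variable {V : Type w} {B : Type w'}

/-- Openness of a subgroup of `Π_A` is invariant under conjugation (conjugation is a homeomorphism).
[cite: MochizukiSemiAnbd2006, Def 5.3 (i) p.65] -/
theorem isOpen_conjSubgroup_iff' (a : PA) (S : Subgroup PA) :
    IsOpen ((conjSubgroup a S : Subgroup PA) : Set PA) ↔ IsOpen (S : Set PA) := by
  have hφ : ((conjSubgroup a S : Subgroup PA) : Set PA) =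
      (Homeomorph.mulLeft a).trans (Homeomorph.mulRight a⁻¹) '' (S : Set PA) := by
    ext x
    simp only [conjSubgroup, Subgroup.coe_map, MulEquiv.coe_toMonoidHom, MulAut.conj_apply, Set.mem_image,
      SetLike.mem_coe, Homeomorph.trans_apply, Homeomorph.coe_mulLeft, Homeomorph.coe_mulRight]
  rw [hφ]
  exact Homeomorph.isOpen_image _

/-- **The estrangement contradiction, image form** (Def. 5.3 (ii) p. 65, as USED in the proof of Thm 5.4 (i)
p. 66): if every edge is arithmetically estranged and `C` is arithmetically ample, then `aug(C)` lies in no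
`Π_A`-conjugate `a · aug(Π_b ∩ h·Π_{b'}·h⁻¹) · a⁻¹` with `b`, `b'` abutting to one vertex `v`, `h ∈ Π_v` and
`b' ≠ b ∨ h ∉ Π_b` — for then `aug(Π_b ∩ h·Π_{b'}·h⁻¹) ⊇ a⁻¹ · aug(C) · a` would be open.
[cite: MochizukiSemiAnbd2006, Def 5.3 (ii) p.65] -/
theorem not_map_le_of_isTotallyArithEstranged {D : DecompositionData Gtp V B} {aug : Gtp →* PA}
    (hest : IsTotallyArithEstranged D aug) {C : Subgroup Gtp} (hC : IsArithAmple aug C)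
    {b b' : B} {v : V} (hb : D.abut b = some v) (hb' : D.abut b' = some v) {h : Gtp}
    (hh : h ∈ D.vertGp v) (hbb : b' ≠ b ∨ h ∉ D.brGp b) (a : PA) :
    ¬ C.map aug ≤ conjSubgroup a ((D.brGp b ⊓ conjSubgroup h (D.brGp b')).map aug) := by
  intro hle
  -- `a⁻¹ · aug(C) · a ≤ aug(Π_b ∩ h Π_{b'} h⁻¹)`
  have hle' : conjSubgroup a⁻¹ (C.map aug) ≤ (D.brGp b ⊓ conjSubgroup h (D.brGp b')).map aug := by
    rintro y ⟨s, hs, rfl⟩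
    obtain ⟨k, hk, rfl⟩ := hle hs
    have : ((MulAut.conj a⁻¹).toMonoidHom ((MulAut.conj a).toMonoidHom k) : PA) = k := by
      simp only [MulEquiv.coe_toMonoidHom, MulAut.conj_apply, inv_inv]
      group
    rw [this]
    exact hk
  have hamp : IsArithAmple aug (D.brGp b ⊓ conjSubgroup h (D.brGp b')) :=
    Subgroup.isOpen_mono hle' ((isOpen_conjSubgroup_iff' a⁻¹ _).2 hC)
  obtain ⟨h1, h2⟩ := hest (D.edgeOf b) b rfl v hb h hh
  by_cases hne : b' = b
  · subst hne
    rcases hbb with hne' | hnot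
    · exact hne' rfl
    · exact h2 hnot hamp
  · exact h1 b' hb' hne hamp

end Atoms

/-! ### (∗_j) for compact arithmetically ample subgroups from the dictionary in `Π_A` -/

section NoBranchPair

variable {Gtp : Type u} [Group Gtp] [TopologicalSpace Gtp]
variable {PA : Type u'} [Group PA] [TopologicalSpace PA] [IsTopologicalGroup PA]
variable {V : Type w} {B : Type w'}
variable (D : DecompositionData Gtp V B) (aug : Gtp →* PA)
variable {J : Type v} [Preorder J]
variable (G : J → SemiGraph.{u}) (τ : ∀ j, Gtp →* Aut (G j))
variable (gf : ∀ ⦃i j : J⦄, i ≤ j → (G j ⟶ G i))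

variable {D aug G τ gf}

/-! The WEAKENED arithmetic branch-pair dictionary (AI4″) `hdictA`: "for every COMPACT `C ≤ Π^temp_𝔊` fixing a
compatible finite-level system `(w_i; β_i ≠ β'_i)` of a vertex with two distinct abutting branches, the image
`aug(C)` lies in a `Π_A`-conjugate `a · aug(Π_b ∩ h·Π_{b'}·h⁻¹) · a⁻¹` for some base vertex `v`, branches
`b, b'` abutting to `v`, `h ∈ Π_v` with `b' ≠ b` or `h ∉ Π_b`".  It enters as an explicit binder; no
definition and no named fact is introduced here. -/

omit [TopologicalSpace PA] [IsTopologicalGroup PA] in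
/-- **(AI4′) implies (AI4″)**: the dictionary of abc-iut-w4-d053's `ArithLevelData.stabBranchPair` (full
stabiliser inside a `Π^temp_𝔊`-conjugate) gives the weakened image form, with `a := aug x`.  So nothing
typed against (AI4′) is lost. [cite: MochizukiSemiAnbd2006, Thm 5.4 (i) p.66] -/
theorem augDict_of_dict
    (hdict : ∀ (j₀ : J) (w : ∀ i : {i : J // j₀ ≤ i}, (G i.1).Vertex)
      (β β' : ∀ i : {i : J // j₀ ≤ i}, (G i.1).Branch),
      (∀ i, β i ≠ β' i ∧ (G i.1).abuts (β i) = some (w i) ∧ (G i.1).abuts (β' i) = some (w i)) →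
      (∀ ⦃i i' : {i : J // j₀ ≤ i}⦄ (h : i.1 ≤ i'.1), (gf h).vertexMap (w i') = w i ∧
        (gf h).branchMap (β i') = β i ∧ (gf h).branchMap (β' i') = β' i) →
      ∃ (v : V) (b b' : B) (x h : Gtp), D.abut b = some v ∧ D.abut b' = some v ∧ h ∈ D.vertGp v ∧
        (b' ≠ b ∨ h ∉ D.brGp b) ∧
        ∀ g : Gtp, (∀ i, (τ i.1 g).hom.vertexMap (w i) = w i ∧
          (τ i.1 g).hom.branchMap (β i) = β i ∧ (τ i.1 g).hom.branchMap (β' i) = β' i) →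
          g ∈ conjSubgroup x (D.brGp b ⊓ conjSubgroup h (D.brGp b'))) :
    ∀ (C : Subgroup Gtp), IsCompact (C : Set Gtp) →
      ∀ (j₀ : J) (w : ∀ i : {i : J // j₀ ≤ i}, (G i.1).Vertex)
      (β β' : ∀ i : {i : J // j₀ ≤ i}, (G i.1).Branch),
      (∀ i, β i ≠ β' i ∧ (G i.1).abuts (β i) = some (w i) ∧ (G i.1).abuts (β' i) = some (w i)) →
      (∀ ⦃i i' : {i : J // j₀ ≤ i}⦄ (h : i.1 ≤ i'.1), (gf h).vertexMap (w i') = w i ∧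
        (gf h).branchMap (β i') = β i ∧ (gf h).branchMap (β' i') = β' i) →
      (∀ (i : {i : J // j₀ ≤ i}) (g : Gtp), g ∈ C → (τ i.1 g).hom.vertexMap (w i) = w i ∧
        (τ i.1 g).hom.branchMap (β i) = β i ∧ (τ i.1 g).hom.branchMap (β' i) = β' i) →
      ∃ (v : V) (b b' : B) (a : PA) (h : Gtp), D.abut b = some v ∧ D.abut b' = some v ∧ h ∈ D.vertGp v ∧
        (b' ≠ b ∨ h ∉ D.brGp b) ∧
        C.map aug ≤ conjSubgroup a ((D.brGp b ⊓ conjSubgroup h (D.brGp b')).map aug) := by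
  intro C _ j₀ w β β' hββ hcompat hfix
  obtain ⟨v, b, b', x, h, hb, hb', hh, hbb, hstab⟩ := hdict j₀ w β β' hββ hcompat
  refine ⟨v, b, b', aug x, h, hb, hb', hh, hbb, ?_⟩
  rintro _ ⟨g, hg, rfl⟩
  obtain ⟨k, hk, hkg⟩ := hstab g (fun i => hfix i g hg)
  refine ⟨aug k, ⟨k, hk, rfl⟩, ?_⟩
  rw [← hkg]
  simp only [MulEquiv.coe_toMonoidHom, MulAut.conj_apply, map_mul, map_inv]

omit [TopologicalSpace PA] [IsTopologicalGroup PA] in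
/-- **The compact-restricted `Π^temp_𝔊`-conjugate form implies (AI4″)** (abc-iut-L3-t6's exit (A54):
(AI4′) asserted only for COMPACT `C`): again `a := aug x`. [cite: MochizukiSemiAnbd2006, Thm 5.4 (i) p.66] -/
theorem augDict_of_cptDict
    (hdictC : ∀ (C : Subgroup Gtp), IsCompact (C : Set Gtp) →
      ∀ (j₀ : J) (w : ∀ i : {i : J // j₀ ≤ i}, (G i.1).Vertex)
      (β β' : ∀ i : {i : J // j₀ ≤ i}, (G i.1).Branch),
      (∀ i, β i ≠ β' i ∧ (G i.1).abuts (β i) = some (w i) ∧ (G i.1).abuts (β' i) = some (w i)) →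
      (∀ ⦃i i' : {i : J // j₀ ≤ i}⦄ (h : i.1 ≤ i'.1), (gf h).vertexMap (w i') = w i ∧
        (gf h).branchMap (β i') = β i ∧ (gf h).branchMap (β' i') = β' i) →
      (∀ (i : {i : J // j₀ ≤ i}) (g : Gtp), g ∈ C → (τ i.1 g).hom.vertexMap (w i) = w i ∧
        (τ i.1 g).hom.branchMap (β i) = β i ∧ (τ i.1 g).hom.branchMap (β' i) = β' i) →
      ∃ (v : V) (b b' : B) (x h : Gtp), D.abut b = some v ∧ D.abut b' = some v ∧ h ∈ D.vertGp v ∧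
        (b' ≠ b ∨ h ∉ D.brGp b) ∧ C ≤ conjSubgroup x (D.brGp b ⊓ conjSubgroup h (D.brGp b'))) :
    ∀ (C : Subgroup Gtp), IsCompact (C : Set Gtp) →
      ∀ (j₀ : J) (w : ∀ i : {i : J // j₀ ≤ i}, (G i.1).Vertex)
      (β β' : ∀ i : {i : J // j₀ ≤ i}, (G i.1).Branch),
      (∀ i, β i ≠ β' i ∧ (G i.1).abuts (β i) = some (w i) ∧ (G i.1).abuts (β' i) = some (w i)) →
      (∀ ⦃i i' : {i : J // j₀ ≤ i}⦄ (h : i.1 ≤ i'.1), (gf h).vertexMap (w i') = w i ∧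
        (gf h).branchMap (β i') = β i ∧ (gf h).branchMap (β' i') = β' i) →
      (∀ (i : {i : J // j₀ ≤ i}) (g : Gtp), g ∈ C → (τ i.1 g).hom.vertexMap (w i) = w i ∧
        (τ i.1 g).hom.branchMap (β i) = β i ∧ (τ i.1 g).hom.branchMap (β' i) = β' i) →
      ∃ (v : V) (b b' : B) (a : PA) (h : Gtp), D.abut b = some v ∧ D.abut b' = some v ∧ h ∈ D.vertGp v ∧
        (b' ≠ b ∨ h ∉ D.brGp b) ∧
        C.map aug ≤ conjSubgroup a ((D.brGp b ⊓ conjSubgroup h (D.brGp b')).map aug) := by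
  intro C hC j₀ w β β' hββ hcompat hfix
  obtain ⟨v, b, b', x, h, hb, hb', hh, hbb, hle⟩ := hdictC C hC j₀ w β β' hββ hcompat hfix
  refine ⟨v, b, b', aug x, h, hb, hb', hh, hbb, ?_⟩
  rintro _ ⟨g, hg, rfl⟩
  obtain ⟨k, hk, hkg⟩ := hle hg
  refine ⟨aug k, ⟨k, hk, rfl⟩, ?_⟩
  rw [← hkg]
  simp only [MulEquiv.coe_toMonoidHom, MulAut.conj_apply, map_mul, map_inv]

/-- **A compact arithmetically ample subgroup fixes no compatible finite-level branch-pair system** — from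
the WEAKENED dictionary (AI4″) and total arithmetic estrangement: abc-iut-L3-t11's hypothesis `hnobp` for
`SemiGraph.hstar_of_noFixedBranchPairSystem`, reached through `False` (`not_map_le_of_isTotallyArithEstranged`).
[cite: MochizukiSemiAnbd2006, Thm 5.4 (i) p.66] -/
theorem hnobp_of_isArithAmple_of_augDict
    (hdictA : ∀ (C : Subgroup Gtp), IsCompact (C : Set Gtp) →
      ∀ (j₀ : J) (w : ∀ i : {i : J // j₀ ≤ i}, (G i.1).Vertex)
      (β β' : ∀ i : {i : J // j₀ ≤ i}, (G i.1).Branch),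
      (∀ i, β i ≠ β' i ∧ (G i.1).abuts (β i) = some (w i) ∧ (G i.1).abuts (β' i) = some (w i)) →
      (∀ ⦃i i' : {i : J // j₀ ≤ i}⦄ (h : i.1 ≤ i'.1), (gf h).vertexMap (w i') = w i ∧
        (gf h).branchMap (β i') = β i ∧ (gf h).branchMap (β' i') = β' i) →
      (∀ (i : {i : J // j₀ ≤ i}) (g : Gtp), g ∈ C → (τ i.1 g).hom.vertexMap (w i) = w i ∧
        (τ i.1 g).hom.branchMap (β i) = β i ∧ (τ i.1 g).hom.branchMap (β' i) = β' i) →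
      ∃ (v : V) (b b' : B) (a : PA) (h : Gtp), D.abut b = some v ∧ D.abut b' = some v ∧ h ∈ D.vertGp v ∧
        (b' ≠ b ∨ h ∉ D.brGp b) ∧
        C.map aug ≤ conjSubgroup a ((D.brGp b ⊓ conjSubgroup h (D.brGp b')).map aug))
    (hest : IsTotallyArithEstranged D aug) (C : Subgroup Gtp) (hCc : IsCompact (C : Set Gtp))
    (hC : IsArithAmple aug C)
    (j₀ : J) (w : ∀ i : {i : J // j₀ ≤ i}, (G i.1).Vertex)
    (β β' : ∀ i : {i : J // j₀ ≤ i}, (G i.1).Branch)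
    (hββ : ∀ i, β i ≠ β' i ∧ (G i.1).abuts (β i) = some (w i) ∧ (G i.1).abuts (β' i) = some (w i))
    (hcompat : ∀ ⦃i i' : {i : J // j₀ ≤ i}⦄ (h : i.1 ≤ i'.1), (gf h).vertexMap (w i') = w i ∧
      (gf h).branchMap (β i') = β i ∧ (gf h).branchMap (β' i') = β' i)
    (hfix : ∀ (i : {i : J // j₀ ≤ i}) (γ : C), (τ i.1 γ).hom.vertexMap (w i) = w i ∧
      (τ i.1 γ).hom.branchMap (β i) = β i ∧ (τ i.1 γ).hom.branchMap (β' i) = β' i) :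
    C = ⊥ := by
  obtain ⟨v, b, b', a, h, hb, hb', hh, hbb, hle⟩ :=
    hdictA C hCc j₀ w β β' hββ hcompat (fun i g hg => hfix i ⟨g, hg⟩)
  exact absurd hle (not_map_le_of_isTotallyArithEstranged hest hC hb hb' hh hbb a)

/-- **(∗_j) for a compact arithmetically ample subgroup, from the dictionary in `Π_A`** (the twin of
abc-iut-w4-d029's `hstar_of_isArithAmple` over (AI4″); `IsCompact C` is available at the call site of
abc-iut-w4-d053's packaged Thm 5.4 (i)): over any directed system of trees `T_j` with `Π^temp_𝔊`-actions,
finite levels (immersions, equivariant, compatible transitions) carrying (AI4″), and under total arithmetic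
estrangement, for every `j` there is `i ≥ j` such that all `C`-fixed edges of `T_i` have one image in `T_j`.
[cite: MochizukiSemiAnbd2006, Thm 5.4 (i) p.66] -/
theorem hstar_of_isArithAmple_of_augDict [IsDirectedOrder J]
    (T : J → SemiGraph.{u}) (hT : ∀ j, (T j).IsTree) (ρ : ∀ j, Gtp →* Aut (T j))
    (f : ∀ ⦃i j : J⦄, i ≤ j → (T j ⟶ T i))
    [∀ j, Finite (G j).Vertex] [∀ j, Finite (G j).Branch]
    (q : ∀ j, T j ⟶ G j) (hq : ∀ j, SemiGraph.IsImmersion (q j))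
    (hqe : ∀ (j : J) (g : Gtp), (ρ j g).hom ≫ q j = q j ≫ (τ j g).hom)
    (gf_id : ∀ j, gf (le_refl j) = 𝟙 (G j))
    (gf_comp : ∀ ⦃i j k : J⦄ (hij : i ≤ j) (hjk : j ≤ k), gf hjk ≫ gf hij = gf (hij.trans hjk))
    (hgfe : ∀ ⦃i j : J⦄ (h : i ≤ j) (g : Gtp), (τ j g).hom ≫ gf h = gf h ≫ (τ i g).hom)
    (hsq : ∀ ⦃i j : J⦄ (h : i ≤ j), f h ≫ q i = q j ≫ gf h)
    (hdictA : ∀ (C : Subgroup Gtp), IsCompact (C : Set Gtp) →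
      ∀ (j₀ : J) (w : ∀ i : {i : J // j₀ ≤ i}, (G i.1).Vertex)
      (β β' : ∀ i : {i : J // j₀ ≤ i}, (G i.1).Branch),
      (∀ i, β i ≠ β' i ∧ (G i.1).abuts (β i) = some (w i) ∧ (G i.1).abuts (β' i) = some (w i)) →
      (∀ ⦃i i' : {i : J // j₀ ≤ i}⦄ (h : i.1 ≤ i'.1), (gf h).vertexMap (w i') = w i ∧
        (gf h).branchMap (β i') = β i ∧ (gf h).branchMap (β' i') = β' i) →
      (∀ (i : {i : J // j₀ ≤ i}) (g : Gtp), g ∈ C → (τ i.1 g).hom.vertexMap (w i) = w i ∧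
        (τ i.1 g).hom.branchMap (β i) = β i ∧ (τ i.1 g).hom.branchMap (β' i) = β' i) →
      ∃ (v : V) (b b' : B) (a : PA) (h : Gtp), D.abut b = some v ∧ D.abut b' = some v ∧ h ∈ D.vertGp v ∧
        (b' ≠ b ∨ h ∉ D.brGp b) ∧
        C.map aug ≤ conjSubgroup a ((D.brGp b ⊓ conjSubgroup h (D.brGp b')).map aug))
    (hest : IsTotallyArithEstranged D aug)
    (hbot : ¬ IsArithAmple aug ⊥) (C : Subgroup Gtp) (hCc : IsCompact (C : Set Gtp))
    (hC : IsArithAmple aug C) (j : J) :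
    ∃ (i : J) (h : j ≤ i), ∀ e e' : (T i).Edge, (∀ γ : C, (ρ i γ).hom.edgeMap e = e) →
      (∀ γ : C, (ρ i γ).hom.edgeMap e' = e') → (f h).edgeMap e = (f h).edgeMap e' :=
  SemiGraph.hstar_of_noFixedBranchPairSystem C T hT ρ f G τ q hq hqe gf gf_id gf_comp hgfe hsq
    (fun j₀ w β β' hββ hcompat hfix =>
      hnobp_of_isArithAmple_of_augDict hdictA hest C hCc hC j₀ w β β' hββ hcompat hfix)
    (ne_bot_of_isArithAmple hbot hC) j

end NoBranchPair

end Literature.AnabelianGeometry.SemiGraphs
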